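import Mathlib
import Literature.Analysis.FluidPDE.VectorCalculus

/-!
# Far-field bound for the regularised Biot–Savart field of a proper filament

Tools stub `stub_biotSavartFarField` of line `Sketch` (crux `SkeletonEquilibrium`, thesis
`FilamentSkeletonRss`). For the Rosenhead-regularised Biot–Savart law with core parameter `e`
and a curve `X : ℝ → ℝ³` with `‖X′‖ ≤ 1` and linear growth `c |u| − C ≤ ‖X u‖` (`c > 0`), the
field `∫ ((‖x − X u‖² + e²)^{3/2})⁻¹ • X′(u) × (x − X u) du` at a point `x` at distance `≥ d > 0`
from the curve has norm at most `8 ((|C| + ‖x‖) / (c d²) + 1 / (c d))`, uniformly in `e`.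

Proof: with `r = ‖x − X u‖`, `A = |C| + ‖x‖`, the integrand has norm at most
`r / (r² + e²)^{3/2} ≤ r / r³ = r⁻²`, and `r ≥ d`, `r ≥ c |u| − A`. The elementary inequality
`d · c |u| ≤ (d + A) r` (case split on `c |u| ≤ d + A`) gives the single Cauchy-type majorant
`r⁻² ≤ (2 / d²) (1 + (c u / (d + A))²)⁻¹`, whose integral over `ℝ` is
`(2 / d²) · π (d + A) / c = 2π (d + A) / (c d²) ≤ 8 (d + A) / (c d²)` (`π ≤ 4`), which is the
claimed bound. No piecewise integration is needed; `norm_integral_le_of_norm_le` does not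
require integrability of the vector integrand, so the hypotheses `e ≠ 0` and `ContDiff ℝ 1 X`
are not used.
-/

noncomputable section

open MeasureTheory Filter Topology
open Literature.Analysis.FluidPDE

namespace Summit.NavierStokesRegularity.NavierStokesRegularity.Theorems.SkeletonEquilibrium.Sketch
set_option linter.dupNamespace false

/-- `‖v × w‖ ≤ ‖v‖ ‖w‖` (from `norm_cross`, `sin ≤ 1`). [folklore] -/
private theorem bsff_norm_cross_le (v w : EuclideanSpace ℝ (Fin 3)) :
    ‖cross v w‖ ≤ ‖v‖ * ‖w‖ := by
  -- adapted from FilamentSkeletonRssSkeletonEquilibriumKernelIntegrable (rosenhead_norm_cross_le)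
  rw [norm_cross]
  exact mul_le_of_le_one_right (by positivity) (Real.sin_le_one _)

/-- `b ^ (3/2) = b √b` for `0 < b`. [folklore] -/
private theorem bsff_rpow_three_halves {b : ℝ} (hb : 0 < b) :
    b ^ (3 / 2 : ℝ) = b * Real.sqrt b := by
  rw [show (3 / 2 : ℝ) = 1 + 1 / 2 by norm_num, Real.rpow_add hb, Real.rpow_one, Real.sqrt_eq_rpow]

/-- The `e`-uniform scalar kernel bound `r / (r² + e²)^{3/2} ≤ (r²)⁻¹` for `0 < r`
(since `r² ≤ r² + e²` and `r ≤ √(r² + e²)`). [folklore] -/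
private theorem bsff_kernel_mul_le_inv_sq {r : ℝ} (hr : 0 < r) (e : ℝ) :
    ((r ^ 2 + e ^ 2) ^ (3 / 2 : ℝ))⁻¹ * r ≤ (r ^ 2)⁻¹ := by
  have hb : 0 < r ^ 2 + e ^ 2 := by positivity
  have hs : 0 < Real.sqrt (r ^ 2 + e ^ 2) := Real.sqrt_pos.2 hb
  have h1 : r ^ 2 ≤ r ^ 2 + e ^ 2 := by nlinarith [sq_nonneg e]
  have h2 : r ≤ Real.sqrt (r ^ 2 + e ^ 2) := Real.le_sqrt_of_sq_le h1
  rw [bsff_rpow_three_halves hb, inv_mul_le_iff₀ (mul_pos hb hs), le_mul_inv_iff₀ (pow_pos hr 2)]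
  calc r * r ^ 2 = r ^ 2 * r := mul_comm _ _
    _ ≤ (r ^ 2 + e ^ 2) * Real.sqrt (r ^ 2 + e ^ 2) := mul_le_mul h1 h2 hr.le hb.le

/-- The elementary inequality behind the majorant: if `0 < d ≤ r`, `0 ≤ A`, `0 < c` and
`c |u| − A ≤ r`, then `|d · (c / (d + A)) · u| ≤ r`, i.e. `d c |u| ≤ (d + A) r`
(case split on `c |u| ≤ d + A`). [folklore] -/
private theorem bsff_abs_scaled_le {d A c u r : ℝ} (hd : 0 < d) (hA : 0 ≤ A) (hc : 0 < c)
    (hdr : d ≤ r) (hur : c * |u| - A ≤ r) : |d * (c / (d + A) * u)| ≤ r := by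
  have hdA : 0 < d + A := by linarith
  have key : d * (c * |u|) ≤ r * (d + A) := by
    rcases le_or_gt (c * |u|) (d + A) with h | h
    · nlinarith [mul_nonneg (sub_nonneg.2 hdr) hdA.le, mul_nonneg hd.le (sub_nonneg.2 h)]
    · nlinarith [mul_nonneg (sub_nonneg.2 hur) hdA.le, mul_nonneg hA (sub_nonneg.2 h.le)]
  rw [abs_mul, abs_of_pos hd, abs_mul, abs_of_pos (div_pos hc hdA), div_mul_eq_mul_div,
    mul_div_assoc', div_le_iff₀ hdA]
  exact key

/-- The Cauchy-type majorant: if `0 < d`, `(d k)² ≤ r²` and `d² ≤ r²`, then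
`(r²)⁻¹ ≤ (2 / d²) (1 + k²)⁻¹` (as `d² (1 + k²) = d² + (d k)² ≤ 2 r²`). [folklore] -/
private theorem bsff_inv_sq_le_majorant {d k r : ℝ} (hd : 0 < d) (h1 : (d * k) ^ 2 ≤ r ^ 2)
    (h2 : d ^ 2 ≤ r ^ 2) : (r ^ 2)⁻¹ ≤ 2 / d ^ 2 * (1 + k ^ 2)⁻¹ := by
  have hr2 : 0 < r ^ 2 := lt_of_lt_of_le (pow_pos hd 2) h2
  rw [← div_eq_mul_inv, div_div, inv_eq_one_div, div_le_div_iff₀ hr2 (by positivity)]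
  nlinarith [h1, h2]

/-- The value of the majorant's integral: for `0 < d`, `0 < c`, `0 < d + A`,
`∫ (2 / d²) (1 + (c u / (d + A))²)⁻¹ du = (2 / d²) · ((d + A) / c) · π`
(substitution in `∫ (1 + u²)⁻¹ = π`). [folklore] -/
private theorem bsff_integral_majorant {d A c : ℝ} (hc : 0 < c) (hdA : 0 < d + A) :
    ∫ u : ℝ, 2 / d ^ 2 * (1 + (c / (d + A) * u) ^ 2)⁻¹ = 2 / d ^ 2 * ((d + A) / c * Real.pi) := by
  rw [integral_const_mul, Measure.integral_comp_mul_left (fun y : ℝ => (1 + y ^ 2)⁻¹),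
    integral_univ_inv_one_add_sq, smul_eq_mul, inv_div, abs_of_pos (div_pos hdA hc)]

/-- **Tools stub** (`stub_biotSavartFarField`): the far-field / mutual-induction bound for the
regularised Biot–Savart field of a filament. For `c > 0`, `d > 0`, a curve `X : ℝ → ℝ³` with
`‖X′‖ ≤ 1` and linear growth `c |u| − C ≤ ‖X u‖`, and a point `x` with `‖x − X u‖ ≥ d` for all
`u`, the field `∫ ((‖x − X u‖² + e²)^{3/2})⁻¹ • X′(u) × (x − X u) du` has norm at most
`8 ((|C| + ‖x‖) / (c d²) + 1 / (c d))`, uniformly in the core parameter `e` (pointwise bound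
`r⁻²`, Cauchy majorant `(2/d²)(1 + (c u /(d + |C| + ‖x‖))²)⁻¹`, `π ≤ 4`). [folklore] -/
theorem stub_biotSavartFarField :
    ∀ (e c C d : ℝ) (X : ℝ → EuclideanSpace ℝ (Fin 3)) (x : EuclideanSpace ℝ (Fin 3)),
      e ≠ 0 → 0 < c → 0 < d → ContDiff ℝ 1 X → (∀ u, ‖deriv X u‖ ≤ 1) →
      (∀ u, c * |u| - C ≤ ‖X u‖) → (∀ u, d ≤ ‖x - X u‖) →
      ‖∫ u : ℝ, ((‖x - X u‖ ^ 2 + e ^ 2) ^ (3 / 2 : ℝ))⁻¹ • cross (deriv X u) (x - X u)‖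
        ≤ 8 * ((|C| + ‖x‖) / (c * d ^ 2) + 1 / (c * d)) := by
  intro e c C d X x _he hc hd _hX hdX hgrow hfar
  have hA : 0 ≤ |C| + ‖x‖ := by positivity
  have hdA : 0 < d + (|C| + ‖x‖) := by positivity
  have hg_int : Integrable
      (fun u : ℝ => 2 / d ^ 2 * (1 + (c / (d + (|C| + ‖x‖)) * u) ^ 2)⁻¹) :=
    (integrable_inv_one_add_sq.comp_mul_left' (div_pos hc hdA).ne').const_mul _
  have hbound : ∀ u : ℝ,
      ‖((‖x - X u‖ ^ 2 + e ^ 2) ^ (3 / 2 : ℝ))⁻¹ • cross (deriv X u) (x - X u)‖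
        ≤ 2 / d ^ 2 * (1 + (c / (d + (|C| + ‖x‖)) * u) ^ 2)⁻¹ := by
    intro u
    have hr : d ≤ ‖x - X u‖ := hfar u
    have hrpos : 0 < ‖x - X u‖ := lt_of_lt_of_le hd hr
    have hur : c * |u| - (|C| + ‖x‖) ≤ ‖x - X u‖ := by
      have h1 := hgrow u
      have h2 : ‖X u‖ - ‖x‖ ≤ ‖x - X u‖ := by
        rw [norm_sub_rev]
        exact norm_sub_norm_le _ _
      have h3 : C ≤ |C| := le_abs_self C
      linarith
    have hb : 0 < ‖x - X u‖ ^ 2 + e ^ 2 := by positivity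
    have hsq : (d * (c / (d + (|C| + ‖x‖)) * u)) ^ 2 ≤ ‖x - X u‖ ^ 2 := by
      have h := pow_le_pow_left₀ (abs_nonneg _) (bsff_abs_scaled_le hd hA hc hr hur) 2
      rwa [sq_abs] at h
    rw [norm_smul, norm_inv, Real.norm_of_nonneg (Real.rpow_nonneg hb.le _)]
    calc ((‖x - X u‖ ^ 2 + e ^ 2) ^ (3 / 2 : ℝ))⁻¹ * ‖cross (deriv X u) (x - X u)‖
        ≤ ((‖x - X u‖ ^ 2 + e ^ 2) ^ (3 / 2 : ℝ))⁻¹ * ‖x - X u‖ := by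
          refine mul_le_mul_of_nonneg_left ?_ (inv_nonneg.2 (Real.rpow_nonneg hb.le _))
          calc ‖cross (deriv X u) (x - X u)‖ ≤ ‖deriv X u‖ * ‖x - X u‖ :=
                bsff_norm_cross_le _ _
            _ ≤ 1 * ‖x - X u‖ := mul_le_mul_of_nonneg_right (hdX u) (norm_nonneg _)
            _ = ‖x - X u‖ := one_mul _
      _ ≤ (‖x - X u‖ ^ 2)⁻¹ := bsff_kernel_mul_le_inv_sq hrpos e
      _ ≤ 2 / d ^ 2 * (1 + (c / (d + (|C| + ‖x‖)) * u) ^ 2)⁻¹ :=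
          bsff_inv_sq_le_majorant hd hsq (pow_le_pow_left₀ hd.le hr 2)
  have hc' : c ≠ 0 := hc.ne'
  have hd' : d ≠ 0 := hd.ne'
  have key1 : 2 / d ^ 2 * ((d + (|C| + ‖x‖)) / c * Real.pi)
      = (2 * Real.pi) * ((d + (|C| + ‖x‖)) / (c * d ^ 2)) := by
    field_simp
  have key2 : 8 * ((|C| + ‖x‖) / (c * d ^ 2) + 1 / (c * d))
      = 8 * ((d + (|C| + ‖x‖)) / (c * d ^ 2)) := by
    field_simp
    ring
  calc ‖∫ u : ℝ, ((‖x - X u‖ ^ 2 + e ^ 2) ^ (3 / 2 : ℝ))⁻¹ • cross (deriv X u) (x - X u)‖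
      ≤ ∫ u : ℝ, 2 / d ^ 2 * (1 + (c / (d + (|C| + ‖x‖)) * u) ^ 2)⁻¹ :=
        norm_integral_le_of_norm_le hg_int (Eventually.of_forall hbound)
    _ = 2 / d ^ 2 * ((d + (|C| + ‖x‖)) / c * Real.pi) := bsff_integral_majorant hc hdA
    _ = (2 * Real.pi) * ((d + (|C| + ‖x‖)) / (c * d ^ 2)) := key1
    _ ≤ 8 * ((d + (|C| + ‖x‖)) / (c * d ^ 2)) :=
        mul_le_mul_of_nonneg_right (by linarith [Real.pi_le_four]) (by positivity)
    _ = 8 * ((|C| + ‖x‖) / (c * d ^ 2) + 1 / (c * d)) := key2.symm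

end Summit.NavierStokesRegularity.NavierStokesRegularity.Theorems.SkeletonEquilibrium.Sketch
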